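import Mathlib
import HarnessLib

/-!
# S1a — R4c cusp, brick (b3-model): LOCALISING A PINNED FREE MODEL — `C[1/b] ≃ K[1/(q·b′)]` from `Φ : C ≃ K[1/q]` with `Φ b ~ b′/1`

[OURS · L1 W4.5c · lead-1 g17; plan-1 RULING R-F15v (2) ★ R4c `cusp_killsIn_two`, SPEC `Cruxes/CyclicQuotientFourfolds/Lines/s1a_logminvertex-R4c-SPEC.md` §2 (2O)/(2Q):
the cusp's member charts are proper invariant basic opens `U = W ∩ D(b)` of the producer charts `W` (the member-row unit `h_O = 2X₂′ − 3sX₁′²` resp. `h_Q` and the second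
norm are inverted), so the pinned free model `Φ : ChartRing ≃ k[s, x′][1/q]` of `W` (✓`FreeModel.exists_chartFreeModelEquiv`) must be LOCALISED: this file produces
`Φ′ : ChartRing[1/b] ≃ k[s, x′][1/(q·b′)]` whenever `Φ b` is associated to `b′/1`, with the pin `Φ′ ((Φ⁻¹(a/1))/1) = a/1` (all pins of `Φ` are of this form), by
Mathlib's `IsLocalization.ringEquivOfRingEquiv`, `IsLocalization.Away.mul_of_associated` and `IsLocalization.algEquiv`] — NOT statements of the manuscript; counted 0;
AI-level work, weaker than expert review. Crux stmt-ResolutionOfSingularities-17941 `CyclicQuotientFourfolds`, line `s1a-logminvertex` v13 (`stub_reachLowerInFX`).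
-/

set_option linter.dupNamespace false

noncomputable section

namespace Summit.ResolutionOfSingularities.ResolutionOfSingularities.Theorems.WildQuotientResolution.S1.FreeModel

set_option maxHeartbeats 1600000 in
/-- ★ **Localised free model.** For `Φ : C ≃+* K[1/q]`, `b ∈ C` and `b′ ∈ K` with `Φ b` associated to `b′/1`: a ring isomorphism `Φ′ : C[1/b] ≃+* K[1/(q·b′)]`
with `Φ′((Φ⁻¹(a/1))/1) = a/1` for all `a ∈ K` (so every pin `Φ(x) = a/1` of `Φ` becomes the pin `Φ′(x/1) = a/1`). [folklore; Mathlib localisation API] -/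
theorem exists_awayModelEquiv {C K : Type} [CommRing C] [CommRing K] (q : K) (Φ : C ≃+* Localization.Away q) (b : C) (b' : K)
    (hb : Associated (Φ b) (algebraMap K (Localization.Away q) b')) :
    ∃ Φ' : Localization.Away b ≃+* Localization.Away (q * b'),
      (∀ a : K, Φ' (algebraMap C (Localization.Away b) (Φ.symm (algebraMap K (Localization.Away q) a))) = algebraMap K (Localization.Away (q * b')) a) ∧
      (∀ x : C, ∀ a : K, Φ x = algebraMap K (Localization.Away q) a → Φ' (algebraMap C (Localization.Away b) x) = algebraMap K (Localization.Away (q * b')) a) := by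
  classical
  -- step A: transport the localisation along `Φ`
  have H : (Submonoid.powers b).map Φ.toMonoidHom = Submonoid.powers (Φ b) := Submonoid.map_powers _ _
  let e₁ : Localization.Away b ≃+* Localization.Away (Φ b) :=
    IsLocalization.ringEquivOfRingEquiv (Localization.Away b) (Localization.Away (Φ b)) Φ H
  have he₁ : ∀ x : C, e₁ (algebraMap C (Localization.Away b) x) = algebraMap (Localization.Away q) (Localization.Away (Φ b)) (Φ x) := fun x =>
    IsLocalization.ringEquivOfRingEquiv_eq H x
  -- step B: `K[1/q][1/Φ b]` is `K[1/(q b′)]`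
  haveI : IsLocalization.Away (q * b') (Localization.Away (Φ b)) :=
    IsLocalization.Away.mul_of_associated (S := Localization.Away q) q b' (Φ b) hb.symm
  let e₂ : Localization.Away (Φ b) ≃ₐ[K] Localization.Away (q * b') :=
    IsLocalization.algEquiv (Submonoid.powers (q * b')) (Localization.Away (Φ b)) (Localization.Away (q * b'))
  refine ⟨e₁.trans e₂.toRingEquiv, fun a => ?_, fun x a hx => ?_⟩
  · rw [RingEquiv.trans_apply, he₁, Φ.apply_symm_apply]
    rw [← IsScalarTower.algebraMap_apply]
    exact e₂.commutes a
  · rw [RingEquiv.trans_apply, he₁, hx, ← IsScalarTower.algebraMap_apply]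
    exact e₂.commutes a

/-- The pin of the localised model on `b` itself, when `Φ b = u · b′/1`: `Φ′(b/1) = Φ′((Φ⁻¹ u)/1) · (b′/1)` — in particular `Φ′(b/1)` and `b′/1` are associated
(both are units of `K[1/(q b′)]`). [folklore] -/
theorem isUnit_algebraMap_mul_right {K : Type} [CommRing K] (q b' : K) : IsUnit (algebraMap K (Localization.Away (q * b')) b') :=
  IsLocalization.Away.isUnit_of_dvd (x := q * b') (Dvd.intro_left q rfl)

/-- `q/1` is a unit of `K[1/(q b′)]`. [folklore] -/
theorem isUnit_algebraMap_mul_left {K : Type} [CommRing K] (q b' : K) : IsUnit (algebraMap K (Localization.Away (q * b')) q) :=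
  IsLocalization.Away.isUnit_of_dvd (x := q * b') (Dvd.intro b' rfl)

end Summit.ResolutionOfSingularities.ResolutionOfSingularities.Theorems.WildQuotientResolution.S1.FreeModel

end
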